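import Summits.AtomisticToContinuum.HydrodynamicLimit.Theorems.RelayRaceLocalityNearConstantShortTimeHLMomentCapDefs
import HarnessLib

/-!
# Crux `NearConstantShortTimeHL` (stmt-AtomisticToContinuum-12502), line `small-tilt-domination` — the INTEGRATED FOURTH-MOMENT CAP:
# re-typed closure inputs S2‴/S3‴ and the dynamic theorem without the quartic a-priori input (typed statements, lead c8)

Reviewed Defs file of the line (skeleton v18, lead prover-line-stmt-AtomisticToContinuum-12502-c8-0). WHY: skeleton v14–v17 (lead c7) closes
the crux from FOUR dynamical conjectures (`nearConstantShortTimeHL_of_dynamics4`, `…TiltL2Assembly`): the equilibrium closure tightness under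
the fourth-moment cap `n⁻¹ Σᵢ ‖vᵢ(r)‖⁴ ≤ K` FOR ALL `r` in the window (`MomentumClosureTightness4`, `EnergyClosureTightness4`, rate `c₀(M, K)`),
the a-priori caps `TrueLawCapsG`, and S4d `FourthMomentCapPreShock` — a SHARP one-sided law of large numbers for the (non-conserved) quartic
velocity moment, uniformly in time, along the TRUE non-equilibrium law, nearly as strong as the conclusion. S4d is only needed because a
sup-in-time cap cannot be controlled from bounds in mean. Two changes make it superfluous:
* the cap inside the equilibrium events becomes the INTEGRATED cap `∫_{window} n⁻¹ Σᵢ ‖vᵢ(r)‖⁴ dr ≤ K` (`intMomentCapOn`, an `ℝ≥0∞`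
  set-lintegral, monotone in the window with no integrability proviso), and the rate `c₀ = c₀(M)` is chosen BEFORE the cap level `K`, which
  is quantified innermost (for every `K`, eventually in `N`; `N₀` may depend on `K`). Needle-beam pricing is unchanged: a beam family of mass
  fraction `f` and speed `V` carrying a momentum-flux defect `δ` over a window of length `τ` has `f V² ≍ δ/τ`; the integrated cap gives
  `τ f V⁴ ≤ K`, so `f ≥ δ²/(K τ)` is bounded below at fixed `(K, τ, δ)` and the sub-`ℓ_n` phase-space localisation of the beams costs
  `≳ (δ²/(Kτ)) n log n` — superlinear, hence below `e^{-c₀ n}` eventually in `N` for EVERY `K` with the same `c₀`; walls, rafts and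
  collisional patterns have thermal quartic moment and never see the cap. (`MomentumClosureTightnessI`, `EnergyClosureTightnessI` below.)
* along the TRUE law the integrated cap on `[0, t]` fails with probability `≤ 2 t A/(a² K)` by Tonelli along the jointly measurable flow and
  Markov, from the Gaussian tails in mean `E[n⁻¹ Σᵢ e^{a‖vᵢ(s)‖²}] ≤ A` on `[0, t]` that `TrueLawCapsG` (c′) already provides
  (`x⁴ ≤ (2/a²) e^{a x²}`); the good-event extraction runs with cap level `K_i → ∞` tied to the diagonal grid index, so the bad sets have
  mass `≤ b_i → 0` and the dynamic theorem keeps its conclusion. (`DynamicTheoremI` below: `DynamicTheorem4` with the cap-failure limit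
  `hcapM` replaced by the Markov-rate hypothesis `hcapI` and the closure bounds in `∀ K` form.)
Net effect on the line: the crux follows from THREE conjectures, `MomentumClosureTightnessI → EnergyClosureTightnessI → TrueLawCapsG →
NearConstantShortTimeHL` (file `…EndgameI`, to land), and the only inputs along the true law are the speed cap, the ball-packing cap and
Gaussian velocity tails in mean.

Contents (statements only, no mathematics): `intMomentCapOn`; `MomentumClosureTightnessI` (S2‴), `EnergyClosureTightnessI` (S3‴);
`DynamicTheoremI`. PROVED (sanity of the re-typing): `intMomentCapOn_mono` (restriction to sub-windows), `intMomentCapOn_of_momentCapOn`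
(on a window of length `≤ 1` the sup cap implies the integrated cap at the same level), `momentumClosureTightness4_of_I`,
`energyClosureTightness4_of_I` — the NEW K-stubs imply the v14 ones (so v18 asks for MORE on the equilibrium side and NOTHING quartic on
the true-law side).
References: H.-T. Yau, Lett. Math. Phys. 22 (1991) §2; C. Kipnis – C. Landim (1999) Ch. 10 Thm 3.1 (stochastic template).
-/

noncomputable section

namespace Summit.AtomisticToContinuum.HydrodynamicLimit.Theorems.NearConstantShortTimeHL

open scoped BigOperators ENNReal
open MeasureTheory Set Filter Topology
open Literature.MathematicalPhysics.KineticTheory Literature.Analysis.FluidPDE Literature.Analysis.FunctionSpaces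

variable {ε : ℝ} {n : ℕ}

/-- The INTEGRATED FOURTH-MOMENT CAP along an orbit: `∫_{S} n⁻¹ Σᵢ ‖vᵢ(r)‖⁴ dr ≤ K`, as a set-lintegral in `ℝ≥0∞` (monotone in `S`
without any integrability proviso; for a good initial datum the integrand is piecewise constant in `r`). [folklore] -/
def intMomentCapOn (Φ : HardSphereFlow (Torus.geometry (Fin 3)) ε n) (z : Config n (Fin 3) T3) (S : Set ℝ) (K : ℝ) : Prop :=
  ∫⁻ r in S, ENNReal.ofReal ((n : ℝ)⁻¹ * ∑ i, ‖((Φ.flow r z) i).2‖ ^ 4) ≤ ENNReal.ofReal K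

/-- **S2‴ — MOMENTUM CLOSURE TIGHTNESS AT A UNIFORM RATE UNDER THE INTEGRATED FOURTH-MOMENT CAP** (K-stub of skeleton v18; OPEN,
delegated-grade). The frame of `MomentumClosureTightness4` (general families, drifted constant reference `(ā, ū, θe)` in the `M`-box, windows
`[s, s+τ] ⊆ [0,1]`, vector tests normalised in `C¹`, ball averages at `ℓ_n = n^{-1/4}`, speed cap `n^{1/24}` and ball-packing cap `η₁` INSIDE
the event) with TWO changes: the conditioning event carries the INTEGRATED cap `∫_s^{s+τ} n⁻¹ Σᵢ ‖vᵢ(r)‖⁴ dr ≤ K` instead of the sup cap, and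
the rate `c₀ > 0` is chosen after `M` ONLY — the cap level `K > 0` is quantified innermost (for every `K`, eventually in `N`). Cheap witnesses
as for S2″: sub-`ℓ_n` shear / sound / thermal patterns decay in `≤ n^{-1/6} ≪ τ`; hot bursts inside the speed cap thermalise in `n^{-3/8}`;
vacuum-protected needle beams need mass fraction `≥ δ²/(Kτ)` under the integrated cap and then cost `≳ (δ²/(Kτ)) n log n` (superlinear, so
the rate is uniform in `K` eventually in `N`); rarefied collisionless pockets carry flux `O(ε)` under the speed cap. [cite: Yau1991, §2] -/
@[conjecture] def MomentumClosureTightnessI : Prop :=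
  ∃ η₁ : ℝ, 0 < η₁ ∧ ∀ M : ℝ, 1 ≤ M → ∃ c₀ : ℝ, 0 < c₀ ∧ ∀ (abar θe : ℝ) (ubar : V3),
    M⁻¹ ≤ abar → abar ≤ M → M⁻¹ ≤ θe → θe ≤ M → ‖ubar‖ ≤ M →
    ∃ σ₀ : ℝ, 0 < σ₀ ∧ ∀ σ : ℝ, 0 < σ → σ < σ₀ →
    ∀ (ε : ℕ → ℝ) (n : ℕ → ℕ), (∀ N, 0 < ε N) → Tendsto ε atTop (nhds 0) →
    Tendsto (fun N => (n N : ℝ) * ε N ^ 3) atTop (nhds (σ ^ 3)) →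
    ∀ Φ : (N : ℕ) → HardSphereFlow (Torus.geometry (Fin 3)) (ε N) (n N),
    ∀ (s τ : ℝ), 0 ≤ s → 0 < τ → s + τ ≤ 1 →
    ∀ ψ : ℝ → T3 → V3, Torus.IsSmoothSpaceTimeOn (Set.Icc s (s + τ)) ψ →
    (∀ r ∈ Set.Icc s (s + τ), ∀ x, ‖ψ r x‖ ≤ 1 ∧ ‖Torus.timeDerivWithin (Set.Icc s (s + τ)) ψ r x‖ ≤ 1 ∧
      ∀ i, ‖Torus.partialDeriv i (ψ r) x‖ ≤ 1) →
    ∀ δ : ℝ, 0 < δ → ∀ K : ℝ, 0 < K → ∀ᶠ N : ℕ in atTop,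
      particleLaw (Φ N) (canonicalDensity (Torus.geometry (Fin 3)) (ε N) (n N)
          (localGibbsProfile (fun _ => abar) (fun _ => ubar) (fun _ => θe)))
        {z | speedCapOn (Φ N) z (Set.Icc s (s + τ)) ((n N : ℝ) ^ (1 / 24 : ℝ)) ∧
             packCapOn (Φ N) z (Set.Icc s (s + τ)) (mesoRadius (n N)) σ η₁ ∧
             intMomentCapOn (Φ N) z (Set.Icc s (s + τ)) K ∧
             δ < |momDefect σ (Φ N) z (mesoRadius (n N)) s τ ψ|}
        ≤ ENNReal.ofReal (Real.exp (-(c₀ * n N)))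

/-- **S3‴ — ENERGY CLOSURE TIGHTNESS AT A UNIFORM RATE UNDER THE INTEGRATED FOURTH-MOMENT CAP** (the energy twin of S2‴: the frame of
`EnergyClosureTightness4` with the integrated cap in the event, the rate chosen after `M` only and the cap level innermost; OPEN,
delegated-grade). The drifting needle-beam witness against `EnergyClosureCost` (stmt-14426) dies under the integrated cap for the same reason.
[cite: Yau1991, §2] -/
@[conjecture] def EnergyClosureTightnessI : Prop :=
  ∃ η₁ : ℝ, 0 < η₁ ∧ ∀ M : ℝ, 1 ≤ M → ∃ c₀ : ℝ, 0 < c₀ ∧ ∀ (abar θe : ℝ) (ubar : V3),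
    M⁻¹ ≤ abar → abar ≤ M → M⁻¹ ≤ θe → θe ≤ M → ‖ubar‖ ≤ M →
    ∃ σ₀ : ℝ, 0 < σ₀ ∧ ∀ σ : ℝ, 0 < σ → σ < σ₀ →
    ∀ (ε : ℕ → ℝ) (n : ℕ → ℕ), (∀ N, 0 < ε N) → Tendsto ε atTop (nhds 0) →
    Tendsto (fun N => (n N : ℝ) * ε N ^ 3) atTop (nhds (σ ^ 3)) →
    ∀ Φ : (N : ℕ) → HardSphereFlow (Torus.geometry (Fin 3)) (ε N) (n N),
    ∀ (s τ : ℝ), 0 ≤ s → 0 < τ → s + τ ≤ 1 →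
    ∀ φ : ℝ → T3 → ℝ, Torus.IsSmoothSpaceTimeOn (Set.Icc s (s + τ)) φ →
    (∀ r ∈ Set.Icc s (s + τ), ∀ x, |φ r x| ≤ 1 ∧ |Torus.timeDerivWithin (Set.Icc s (s + τ)) φ r x| ≤ 1 ∧
      ∀ i, |Torus.partialDeriv i (φ r) x| ≤ 1) →
    ∀ δ : ℝ, 0 < δ → ∀ K : ℝ, 0 < K → ∀ᶠ N : ℕ in atTop,
      particleLaw (Φ N) (canonicalDensity (Torus.geometry (Fin 3)) (ε N) (n N)
          (localGibbsProfile (fun _ => abar) (fun _ => ubar) (fun _ => θe)))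
        {z | speedCapOn (Φ N) z (Set.Icc s (s + τ)) ((n N : ℝ) ^ (1 / 24 : ℝ)) ∧
             packCapOn (Φ N) z (Set.Icc s (s + τ)) (mesoRadius (n N)) σ η₁ ∧
             intMomentCapOn (Φ N) z (Set.Icc s (s + τ)) K ∧
             δ < |enDefect σ (Φ N) z (mesoRadius (n N)) s τ φ|}
        ≤ ENNReal.ofReal (Real.exp (-(c₀ * n N)))

/-- **THE DYNAMIC THEOREM AT FIXED DATA UNDER THE INTEGRATED FOURTH-MOMENT CAP** (level 1 of the Grönwall assembly of skeleton v18):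
verbatim `DynamicTheorem4` (`…MomentCapDefs`) with (i) the cap-failure limit `hcapM` (probability `→ 0` that the sup cap at a fixed level fails,
the consumer of S4d) REPLACED by the Markov-rate hypothesis `hcapI` — for every level `K > 0`, eventually in `N`, the integrated quartic moment
on `[0, t]` exceeds `K` with probability `≤ C₄ / K` (`0 ≤ C₄`; provable from the Gaussian tails `hgauss` by Tonelli along the flow and Markov),
and (ii) the two equilibrium closure bounds `hKmom` / `hKen` in `∀ K` form with the integrated cap `intMomentCapOn … K` in their events. Same
conclusion. Proof (file `…DynamicI`): the landed proof of `dynamic_theorem4` with the good events rebuilt (`good_event_packageI`: cap level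
`K_i → ∞` along the diagonal grid index). [cite: Yau1991, §2] -/
@[conjecture] def DynamicTheoremI : Prop :=
    ∀ {η₀ : ℝ} {F : ℝ → ℝ} (hη₀ : 0 < η₀) (hFa : AnalyticOnNhd ℝ F (Set.Ioo (-η₀) η₀))
    (hEq : Set.EqOn hsExcessFreeEnergy F (Set.Ico 0 η₀))
    {σ T : ℝ} (hσ : 0 < σ) {ρ θ : ℝ → T3 → ℝ} {u : ℝ → T3 → V3} (hE : IsHardSphereEulerSolution σ T ρ u θ)
    {t : ℝ} (ht : t ∈ Set.Ico 0 T) (ht1 : t < 1) (hband : ∀ s ∈ Set.Icc 0 t, ∀ x, ρ s x * σ ^ 3 < η₀)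
    (hmass : ∫ x, ρ 0 x = 1)
    {ηP : ℝ} (hηP : 0 < ηP) (hηP₀ : ηP < η₀)
    {ε : ℕ → ℝ} {n : ℕ → ℕ} (hn : Tendsto n atTop atTop) (hε : ∀ N, 0 < ε N)
    (Φ : (N : ℕ) → HardSphereFlow (Torus.geometry (Fin 3)) (ε N) (n N))
    (P : (N : ℕ) → Measure (Config (n N) (Fin 3) T3))
    (hPdef : ∀ N, P N = particleLaw (Φ N) (canonicalDensity (Torus.geometry (Fin 3)) (ε N) (n N)
    (localGibbsProfile (fun x => ρ 0 x * Real.exp (gChem σ (ρ 0 x))) (u 0) (θ 0))))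
    (hP : ∀ N, IsProbabilityMeasure (P N))
    {π₀ : ℝ} {πst : ℝ → ℝ}
    (hπ₀ : Tendsto (fun N => (n N : ℝ)⁻¹ * Real.log (canonicalPartition (Torus.geometry (Fin 3)) (ε N) (n N)
    (localGibbsProfile (fun x => ρ 0 x * Real.exp (gChem σ (ρ 0 x))) (u 0) (θ 0)))) atTop (nhds π₀))
    (hπ : TendstoUniformlyOn (fun N r => (n N : ℝ)⁻¹ * Real.log (canonicalPartition (Torus.geometry (Fin 3)) (ε N) (n N)
    (localGibbsProfile (fun x => ρ r x * Real.exp (gChem σ (ρ r x))) (u r) (θ r)))) πst atTop (Set.Icc 0 t))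
    (hm₀ : Tendsto (fun N => ∫ z, logProfileObs σ ρ θ u 0 z ∂(P N)) atTop
    (nhds (∫ x, ρ 0 x * (Real.log (ρ 0 x) + gChem σ (ρ 0 x) - 3 / 2 * Real.log (2 * Real.pi * θ 0 x) - 3 / 2))))
    (hm₀i : ∀ᶠ N : ℕ in atTop, Integrable (fun z => logProfileObs σ ρ θ u 0 z) (P N))
    (hiso : ∀ r ∈ Set.Icc 0 t,
    (∫ x, ρ 0 x * (Real.log (ρ 0 x) + gChem σ (ρ 0 x) - 3 / 2 * Real.log (2 * Real.pi * θ 0 x) - 3 / 2)) - π₀ =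
    (∫ x, ρ r x * (Real.log (ρ r x) + gChem σ (ρ r x) - 3 / 2 * Real.log (2 * Real.pi * θ r x) - 3 / 2)) - πst r)
    {γ : ℝ} (hγ : 0 < γ)
    (hSt2 : ∀ κ : ℝ, 0 < κ → ∀ᶠ N : ℕ in atTop, ∀ r ∈ Set.Icc 0 t,
    ∫⁻ w, ENNReal.ofReal (Real.exp (γ * (n N : ℝ) * fluctuationE (mesoRadius (n N)) (ρ r) (θ r) (u r) w))
    ∂(particleLaw (Φ N) (canonicalDensity (Torus.geometry (Fin 3)) (ε N) (n N)
    (localGibbsProfile (fun x => ρ r x * Real.exp (gChem σ (ρ r x))) (u r) (θ r)))) ≤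
    ENNReal.ofReal (Real.exp (κ * (n N : ℝ))))
    (hcapV : Tendsto (fun N => P N {z | ∃ r ∈ Set.Icc 0 t, ∃ i, (n N : ℝ) ^ (1 / 24 : ℝ) < ‖((Φ N).flow r z i).2‖})
    atTop (nhds 0))
    (hcapP : Tendsto (fun N => P N {z | ∃ r ∈ Set.Icc 0 t, ∃ x : T3,
    ηP < empiricalDensityField ((Φ N).flow r z) (ballKernel (mesoRadius (n N)) x) * σ ^ 3}) atTop (nhds 0))
    {C₄ : ℝ} (hC₄ : 0 ≤ C₄)
    (hcapI : ∀ K : ℝ, 0 < K → ∀ᶠ N : ℕ in atTop, P N {z | ENNReal.ofReal K <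
      ∫⁻ r in Set.Icc 0 t, ENNReal.ofReal ((n N : ℝ)⁻¹ * ∑ i : Fin (n N), ‖((Φ N).flow r z i).2‖ ^ 4)} ≤
      ENNReal.ofReal (C₄ / K))
    {a A : ℝ} (ha : 0 < a) (hA : 0 ≤ A)
    (hgauss : ∀ᶠ N : ℕ in atTop, ∀ s ∈ Set.Icc 0 t,
    ∫⁻ z, ENNReal.ofReal ((n N : ℝ)⁻¹ * ∑ i : Fin (n N), Real.exp (a * ‖((Φ N).flow s z i).2‖ ^ 2)) ∂(P N) ≤
    ENNReal.ofReal A)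
    (G : (N : ℕ) → Measure (Config (n N) (Fin 3) T3)) {aI c₀ : ℝ} (haI : aI < c₀)
    (hImp : ∀ N (S : Set (Config (n N) (Fin 3) T3)), P N S ≤ ENNReal.ofReal (Real.exp (aI * n N)) * G N S)
    {η₂ η₃ : ℝ} (hη₂ : ηP ≤ η₂) (hη₃ : ηP ≤ η₃)
    (hKmom : ∀ K : ℝ, 0 < K → ∀ (s τ : ℝ), 0 ≤ s → 0 < τ → s + τ ≤ 1 →
    ∀ ψ : ℝ → T3 → V3, Torus.IsSmoothSpaceTimeOn (Set.Icc s (s + τ)) ψ →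
    (∀ r ∈ Set.Icc s (s + τ), ∀ x, ‖ψ r x‖ ≤ 1 ∧ ‖Torus.timeDerivWithin (Set.Icc s (s + τ)) ψ r x‖ ≤ 1 ∧
    ∀ i, ‖Torus.partialDeriv i (ψ r) x‖ ≤ 1) →
    ∀ δ : ℝ, 0 < δ → ∀ᶠ N : ℕ in atTop,
    G N {z | speedCapOn (Φ N) z (Set.Icc s (s + τ)) ((n N : ℝ) ^ (1 / 24 : ℝ)) ∧
    packCapOn (Φ N) z (Set.Icc s (s + τ)) (mesoRadius (n N)) σ η₂ ∧
    intMomentCapOn (Φ N) z (Set.Icc s (s + τ)) K ∧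
    δ < |momDefect σ (Φ N) z (mesoRadius (n N)) s τ ψ|} ≤ ENNReal.ofReal (Real.exp (-(c₀ * n N))))
    (hKen : ∀ K : ℝ, 0 < K → ∀ (s τ : ℝ), 0 ≤ s → 0 < τ → s + τ ≤ 1 →
    ∀ φ : ℝ → T3 → ℝ, Torus.IsSmoothSpaceTimeOn (Set.Icc s (s + τ)) φ →
    (∀ r ∈ Set.Icc s (s + τ), ∀ x, |φ r x| ≤ 1 ∧ |Torus.timeDerivWithin (Set.Icc s (s + τ)) φ r x| ≤ 1 ∧
    ∀ i, |Torus.partialDeriv i (φ r) x| ≤ 1) →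
    ∀ δ : ℝ, 0 < δ → ∀ᶠ N : ℕ in atTop,
    G N {z | speedCapOn (Φ N) z (Set.Icc s (s + τ)) ((n N : ℝ) ^ (1 / 24 : ℝ)) ∧
    packCapOn (Φ N) z (Set.Icc s (s + τ)) (mesoRadius (n N)) σ η₃ ∧
    intMomentCapOn (Φ N) z (Set.Icc s (s + τ)) K ∧
    δ < |enDefect σ (Φ N) z (mesoRadius (n N)) s τ φ|} ≤ ENNReal.ofReal (Real.exp (-(c₀ * n N)))),
    ∀ κ : ℝ, 0 < κ → ∀ᶠ N in atTop,
    Integrable (fun z => logProfileObs σ ρ θ u t ((Φ N).flow t z)) (P N) ∧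
    (∫ x, ρ t x * (Real.log (ρ t x) + gChem σ (ρ t x) - 3 / 2 * Real.log (2 * Real.pi * θ t x) - 3 / 2)) - κ ≤
    ∫ z, logProfileObs σ ρ θ u t ((Φ N).flow t z) ∂(P N)

/-! ## Elementary properties of the integrated cap; the re-typed K-stubs are stronger than the v14 ones -/

/-- The integrated fourth-moment cap restricts to sub-windows (monotonicity of the set-lintegral in the set). [folklore] -/
theorem intMomentCapOn_mono {Φ : HardSphereFlow (Torus.geometry (Fin 3)) ε n} {z : Config n (Fin 3) T3} {S S' : Set ℝ} {K : ℝ}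
    (h : intMomentCapOn Φ z S K) (hS : S' ⊆ S) : intMomentCapOn Φ z S' K :=
  (lintegral_mono_set hS).trans h

/-- On a window `[s, s + τ]` of length `τ ≤ 1` the sup cap at level `K` implies the integrated cap at level `K`. [folklore] -/
theorem intMomentCapOn_of_momentCapOn {Φ : HardSphereFlow (Torus.geometry (Fin 3)) ε n} {z : Config n (Fin 3) T3} {s τ K : ℝ}
    (hτ1 : τ ≤ 1) (h : momentCapOn Φ z (Set.Icc s (s + τ)) K) :
    intMomentCapOn Φ z (Set.Icc s (s + τ)) K := by
  unfold intMomentCapOn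
  calc ∫⁻ r in Set.Icc s (s + τ), ENNReal.ofReal ((n : ℝ)⁻¹ * ∑ i, ‖((Φ.flow r z) i).2‖ ^ 4)
      ≤ ∫⁻ _ in Set.Icc s (s + τ), ENNReal.ofReal K :=
        setLIntegral_mono measurable_const fun r hr => ENNReal.ofReal_le_ofReal (h r hr)
    _ = ENNReal.ofReal K * volume (Set.Icc s (s + τ)) := setLIntegral_const _ _
    _ = ENNReal.ofReal K * ENNReal.ofReal τ := by rw [Real.volume_Icc, add_sub_cancel_left]
    _ ≤ ENNReal.ofReal K * 1 := by gcongr; exact ENNReal.ofReal_le_one.2 hτ1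
    _ = ENNReal.ofReal K := mul_one _

/-- **S2‴ ⇒ S2″**: the integrated-cap K-stub implies the v14 sup-cap K-stub (the integrated-cap event CONTAINS the sup-cap event on windows
of length `≤ 1`, and the rate of S2‴ does not depend on the cap level). [folklore] -/
theorem momentumClosureTightness4_of_I : MomentumClosureTightnessI → MomentumClosureTightness4 := by
  rintro ⟨η₁, hη₁, H⟩
  refine ⟨η₁, hη₁, fun M hM K hK => ?_⟩
  obtain ⟨c₀, hc₀, H'⟩ := H M hM
  refine ⟨c₀, hc₀, fun abar θe ubar h1 h2 h3 h4 h5 => ?_⟩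
  obtain ⟨σ₀, hσ₀, H''⟩ := H' abar θe ubar h1 h2 h3 h4 h5
  refine ⟨σ₀, hσ₀, fun σ hσ hσ' ε n hε hε0 hn Φ s τ hs hτ hst ψ hψ hψb δ hδ => ?_⟩
  exact (H'' σ hσ hσ' ε n hε hε0 hn Φ s τ hs hτ hst ψ hψ hψb δ hδ K hK).mono fun N hN => by
    refine le_trans (measure_mono fun z hz => ?_) hN
    simp only [Set.mem_setOf_eq] at hz ⊢
    exact ⟨hz.1, hz.2.1, intMomentCapOn_of_momentCapOn (by linarith) hz.2.2.1, hz.2.2.2⟩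

/-- **S3‴ ⇒ S3″** likewise. [folklore] -/
theorem energyClosureTightness4_of_I : EnergyClosureTightnessI → EnergyClosureTightness4 := by
  rintro ⟨η₁, hη₁, H⟩
  refine ⟨η₁, hη₁, fun M hM K hK => ?_⟩
  obtain ⟨c₀, hc₀, H'⟩ := H M hM
  refine ⟨c₀, hc₀, fun abar θe ubar h1 h2 h3 h4 h5 => ?_⟩
  obtain ⟨σ₀, hσ₀, H''⟩ := H' abar θe ubar h1 h2 h3 h4 h5
  refine ⟨σ₀, hσ₀, fun σ hσ hσ' ε n hε hε0 hn Φ s τ hs hτ hst φ hφ hφb δ hδ => ?_⟩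
  exact (H'' σ hσ hσ' ε n hε hε0 hn Φ s τ hs hτ hst φ hφ hφb δ hδ K hK).mono fun N hN => by
    refine le_trans (measure_mono fun z hz => ?_) hN
    simp only [Set.mem_setOf_eq] at hz ⊢
    exact ⟨hz.1, hz.2.1, intMomentCapOn_of_momentCapOn (by linarith) hz.2.2.1, hz.2.2.2⟩

end Summit.AtomisticToContinuum.HydrodynamicLimit.Theorems.NearConstantShortTimeHL

end
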